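import Mathlib
import Literature.Analysis.FluidPDE.Tao2016AveragedNS.ShiftSetCascadeFlows
import Literature.Analysis.FluidPDE.Tao2016AveragedNS.ShiftSetCascadeFlux
import Summits.NavierStokesRegularity.NavierStokesRegularity.Theorems.TaoLadderRungTwoFlatCertificateGlueFlowStepOn
import HarnessLib

/-!
# Certificate glue on a shift set `𝕊`, XV: TABLE-FORM BOUNDS — the field range, the weighted Lipschitz
  constant and the input defect of the window field from FINITE SUMS over the structure table
  (helper for item stmt-NavierStokesRegularity-22987 `FlatGapCertificatesV2` and stmt-24295 K_A₂(64);
  cell harvest/h2-tao-ladder, p1 g14)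

Glue XI (`stepCert_of_picard`) consumes `FieldRangeOn`, glue XIV (`stepCert_of_flowStep`) consumes `FieldLipOn`
and `InputDefectOn` — each a `∀` over a box of states. This module reduces the three to ONE FINITE INEQUALITY PER
WINDOW COMPONENT `(i, k)`, a sum over `(i₁, i₂, μ) ∈ Fin m × Fin m × 𝕊` of `|α|·clock·(products of box sup bounds,
weights and edge-input bounds)` — closed-form numbers once the data are fixed (the checker's arithmetic):

* `fieldLipOn_of_table` — `Σ |α| c (Ĝ_a ω̂_b + ω̂_a Ĝ_b) ≤ K ω_k` ⇒ `FieldLipOn` (any `𝕊`);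
* `inputDefectOn_of_table` — `Σ_{a or b off the window} |α| c Ĝ⁺_a Ĝ⁺_b ≤ δ ω_k` ⇒ `InputDefectOn`
  (nearest-neighbour `𝕊`);
* `fieldRangeOn_of_table` — `Σ |α| c Ĝ⁺_a Ĝ⁺_b ≤ R_{ik}` ⇒ `FieldRangeOn lo hi (−R) R` (nearest-neighbour `𝕊`);

where `Ĝ` is the zero-extended box sup bound `max |lo| |hi|`, `ω̂` the zero-extended weight, `Ĝ⁺` the box sup
bound extended by `Eb`, `Et` at the two edge shells, `a = k − μ₃ + μ₁`, `b = k − μ₃ + μ₂`, `c = (1+ε₀)^{5(k−μ₃)/2}`.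

HONEST FRAMING: Tao-type MODEL lattices (Tao 2016 §4/§6 vocabulary, shift-set parametrised); inequalities about an
explicit polynomial field, nothing certified, no stub closed, nothing about the Navier–Stokes equations.
-/

noncomputable section

-- the sub-problem namespace repeats the summit name by design (D-0017)
set_option linter.dupNamespace false

namespace Summit.NavierStokesRegularity.NavierStokesRegularity.Theorems

open Set Finset Literature.Analysis.FluidPDE Literature.Analysis.FluidPDE.TaoCascade

namespace CertificateGlueOn

variable {m : ℕ}

/-- Zero-extended box sup bound `Ĝ i n = max |lo i n| |hi i n|` on the window, `0` outside. [folklore] -/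
def boxSup (Kb Ka : ℤ) (lo hi : Fin m → ℤ → ℝ) (i : Fin m) (n : ℤ) : ℝ :=
  if -Kb ≤ n ∧ n ≤ Ka then max |lo i n| |hi i n| else 0

/-- Box sup bound extended by the edge-input bounds `Eb` (shell `-Kb-1`) and `Et` (shell `Ka+1`). [folklore] -/
def boxSupIn (Kb Ka : ℤ) (Eb Et : ℝ) (lo hi : Fin m → ℤ → ℝ) (i : Fin m) (n : ℤ) : ℝ :=
  if -Kb ≤ n ∧ n ≤ Ka then max |lo i n| |hi i n| else if n = -Kb - 1 then Eb else if n = Ka + 1 then Et else 0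

/-- Zero-extended weight. [folklore] -/
def wExt (Kb Ka : ℤ) (ω : ℤ → ℝ) (n : ℤ) : ℝ := if -Kb ≤ n ∧ n ≤ Ka then ω n else 0

variable {𝕊 : Finset (ℤ × ℤ × ℤ)} {ε₀ : ℝ} {α : Fin m → Fin m → Fin m → ℤ × ℤ × ℤ → ℝ} {Kb Ka : ℤ}
  {Eb Et : ℝ} {ω : ℤ → ℝ} {lo hi : Fin m → ℤ → ℝ}

/-- A boxed coordinate is bounded by the box sup bound. [folklore] -/
theorem abs_le_boxSup {Y : Fin m → ℤ → ℝ} (hY : InBoxOn Kb Ka lo hi Y) (i : Fin m) {n : ℤ}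
    (hn : -Kb ≤ n ∧ n ≤ Ka) : |Y i n| ≤ max |lo i n| |hi i n| := by
  obtain ⟨h1, h2⟩ := hY i n hn.1 hn.2
  rw [abs_le]
  constructor
  · have : -|lo i n| ≤ lo i n := neg_abs_le _
    linarith [le_max_left |lo i n| |hi i n|]
  · exact (h2.trans (le_abs_self _)).trans (le_max_right _ _)

/-- The truncated state is bounded by `Ĝ` everywhere. [folklore] -/
theorem abs_trunc_le_boxSup {Y : Fin m → ℤ → ℝ} (hY : InBoxOn Kb Ka lo hi Y) (i : Fin m) (n : ℤ) :
    |(if -Kb ≤ n ∧ n ≤ Ka then Y i n else 0)| ≤ boxSup Kb Ka lo hi i n := by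
  unfold boxSup
  split_ifs with hn
  · exact abs_le_boxSup hY i hn
  · simp

/-- Differences of truncated states are bounded by `D ω̂`. [folklore] -/
theorem abs_trunc_sub_le {Y Y' : Fin m → ℤ → ℝ} {D : ℝ}
    (hD : ∀ i k, -Kb ≤ k → k ≤ Ka → |Y i k - Y' i k| ≤ D * ω k) (i : Fin m) (n : ℤ) :
    |(if -Kb ≤ n ∧ n ≤ Ka then Y i n else 0) - (if -Kb ≤ n ∧ n ≤ Ka then Y' i n else 0)| ≤
      D * wExt Kb Ka ω n := by
  unfold wExt
  split_ifs with hn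
  · exact hD i n hn.1 hn.2
  · simp

/-- `|ab − a'b'| ≤ |a||b − b'| + |a − a'||b'|`. [folklore] -/
theorem abs_mul_sub_mul_le (a b a' b' : ℝ) : |a * b - a' * b'| ≤ |a| * |b - b'| + |a - a'| * |b'| := by
  have : a * b - a' * b' = a * (b - b') + (a - a') * b' := by ring
  rw [this]
  exact (abs_add_le _ _).trans (by rw [abs_mul, abs_mul])

/-- The zero-extended weight is nonnegative for nonnegative weights. [folklore] -/
theorem wExt_nonneg (hω0 : ∀ k, 0 ≤ ω k) (n : ℤ) : 0 ≤ wExt Kb Ka ω n := by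
  unfold wExt; split_ifs
  · exact hω0 n
  · exact le_rfl

/-- The box sup bound is nonnegative. [folklore] -/
theorem boxSup_nonneg (i : Fin m) (n : ℤ) : 0 ≤ boxSup Kb Ka lo hi i n := by
  unfold boxSup; split_ifs
  · exact le_trans (abs_nonneg _) (le_max_left _ _)
  · exact le_rfl

/-- One term of the Lipschitz estimate. [folklore] -/
theorem lip_term (hω0 : ∀ k, 0 ≤ ω k) {Y Y' : Fin m → ℤ → ℝ} {D : ℝ} (hD : 0 ≤ D)
    (hY : InBoxOn Kb Ka lo hi Y) (hY' : InBoxOn Kb Ka lo hi Y')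
    (hdiff : ∀ i k, -Kb ≤ k → k ≤ Ka → |Y i k - Y' i k| ≤ D * ω k) (i₁ i₂ : Fin m) (a b : ℤ) :
    |(if -Kb ≤ a ∧ a ≤ Ka then Y i₁ a else 0) * (if -Kb ≤ b ∧ b ≤ Ka then Y i₂ b else 0) -
        (if -Kb ≤ a ∧ a ≤ Ka then Y' i₁ a else 0) * (if -Kb ≤ b ∧ b ≤ Ka then Y' i₂ b else 0)| ≤
      D * (boxSup Kb Ka lo hi i₁ a * wExt Kb Ka ω b + wExt Kb Ka ω a * boxSup Kb Ka lo hi i₂ b) := by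
  have h1 := abs_trunc_le_boxSup hY i₁ a
  have h2 := abs_trunc_le_boxSup hY' i₂ b
  have h3 := abs_trunc_sub_le (Kb := Kb) (Ka := Ka) (ω := ω) hdiff i₁ a
  have h4 := abs_trunc_sub_le (Kb := Kb) (Ka := Ka) (ω := ω) hdiff i₂ b
  have hG1 := boxSup_nonneg (Kb := Kb) (Ka := Ka) (lo := lo) (hi := hi) i₁ a
  have hwa := wExt_nonneg (Kb := Kb) (Ka := Ka) hω0 a
  refine (abs_mul_sub_mul_le _ _ _ _).trans ?_
  calc _ ≤ boxSup Kb Ka lo hi i₁ a * (D * wExt Kb Ka ω b) + D * wExt Kb Ka ω a * boxSup Kb Ka lo hi i₂ b :=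
        add_le_add (mul_le_mul h1 h4 (abs_nonneg _) hG1)
          (mul_le_mul h3 h2 (abs_nonneg _) (mul_nonneg hD hwa))
    _ = D * (boxSup Kb Ka lo hi i₁ a * wExt Kb Ka ω b + wExt Kb Ka ω a * boxSup Kb Ka lo hi i₂ b) := by
        ring

/-- **WEIGHTED LIPSCHITZ CONSTANT FROM THE TABLE**: if for every window component
`Σ_{i₁,i₂,μ} |α i₁ i₂ i μ| (1+ε₀)^{5(k−μ₃)/2} (Ĝ_{i₁}(a) ω̂(b) + ω̂(a) Ĝ_{i₂}(b)) ≤ K ω_k` then `FieldLipOn … K`.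
[cite: MooreKearfottCloud2009, §6.2–6.4 (interval enclosures of ranges); cell certificate format, box layer] -/
theorem fieldLipOn_of_table (hε : 0 < 1 + ε₀) (hω0 : ∀ k, 0 ≤ ω k) {K : ℝ}
    (htab : ∀ i k, -Kb ≤ k → k ≤ Ka →
      ∑ i₁ : Fin m, ∑ i₂ : Fin m, ∑ μ ∈ 𝕊,
        |α i₁ i₂ i μ| * (1 + ε₀) ^ ((5 : ℝ) * (k - μ.2.2) / 2) *
          (boxSup Kb Ka lo hi i₁ (k - μ.2.2 + μ.1) * wExt Kb Ka ω (k - μ.2.2 + μ.2.1) +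
            wExt Kb Ka ω (k - μ.2.2 + μ.1) * boxSup Kb Ka lo hi i₂ (k - μ.2.2 + μ.2.1)) ≤ K * ω k) :
    FieldLipOn 𝕊 ε₀ α Kb Ka ω lo hi K := by
  intro Y Y' D hD hY hY' hdiff i k hk1 hk2
  unfold truncField quadTermOn
  -- distribute the difference down to single terms
  rw [← Finset.sum_sub_distrib]
  refine (Finset.abs_sum_le_sum_abs _ _).trans ?_
  have hterm : ∀ (i₁ i₂ : Fin m) (μ : ℤ × ℤ × ℤ),
      |α i₁ i₂ i μ * (1 + ε₀) ^ ((5 : ℝ) * (k - μ.2.2) / 2) *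
          ((if -Kb ≤ k - μ.2.2 + μ.1 ∧ k - μ.2.2 + μ.1 ≤ Ka then Y i₁ (k - μ.2.2 + μ.1) else 0) *
            (if -Kb ≤ k - μ.2.2 + μ.2.1 ∧ k - μ.2.2 + μ.2.1 ≤ Ka then Y i₂ (k - μ.2.2 + μ.2.1) else 0)) -
        α i₁ i₂ i μ * (1 + ε₀) ^ ((5 : ℝ) * (k - μ.2.2) / 2) *
          ((if -Kb ≤ k - μ.2.2 + μ.1 ∧ k - μ.2.2 + μ.1 ≤ Ka then Y' i₁ (k - μ.2.2 + μ.1) else 0) *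
            (if -Kb ≤ k - μ.2.2 + μ.2.1 ∧ k - μ.2.2 + μ.2.1 ≤ Ka then Y' i₂ (k - μ.2.2 + μ.2.1) else 0))| ≤
      D * (|α i₁ i₂ i μ| * (1 + ε₀) ^ ((5 : ℝ) * (k - μ.2.2) / 2) *
          (boxSup Kb Ka lo hi i₁ (k - μ.2.2 + μ.1) * wExt Kb Ka ω (k - μ.2.2 + μ.2.1) +
            wExt Kb Ka ω (k - μ.2.2 + μ.1) * boxSup Kb Ka lo hi i₂ (k - μ.2.2 + μ.2.1))) := by
    intro i₁ i₂ μ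
    have hc : 0 ≤ (1 + ε₀) ^ ((5 : ℝ) * (k - μ.2.2) / 2) := (Real.rpow_pos_of_pos hε _).le
    rw [← mul_sub, abs_mul, abs_mul, abs_of_nonneg hc]
    have hb := lip_term hω0 hD hY hY' hdiff i₁ i₂ (k - μ.2.2 + μ.1) (k - μ.2.2 + μ.2.1)
    calc |α i₁ i₂ i μ| * (1 + ε₀) ^ ((5 : ℝ) * (k - μ.2.2) / 2) * _
        ≤ |α i₁ i₂ i μ| * (1 + ε₀) ^ ((5 : ℝ) * (k - μ.2.2) / 2) *
          (D * (boxSup Kb Ka lo hi i₁ (k - μ.2.2 + μ.1) * wExt Kb Ka ω (k - μ.2.2 + μ.2.1) +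
            wExt Kb Ka ω (k - μ.2.2 + μ.1) * boxSup Kb Ka lo hi i₂ (k - μ.2.2 + μ.2.1))) :=
          mul_le_mul_of_nonneg_left hb (mul_nonneg (abs_nonneg _) hc)
      _ = _ := by ring
  have step : ∀ i₁ : Fin m,
      |∑ i₂ : Fin m, ∑ μ ∈ 𝕊, α i₁ i₂ i μ * (1 + ε₀) ^ ((5 : ℝ) * (k - μ.2.2) / 2) *
          ((if -Kb ≤ k - μ.2.2 + μ.1 ∧ k - μ.2.2 + μ.1 ≤ Ka then Y i₁ (k - μ.2.2 + μ.1) else 0) *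
            (if -Kb ≤ k - μ.2.2 + μ.2.1 ∧ k - μ.2.2 + μ.2.1 ≤ Ka then Y i₂ (k - μ.2.2 + μ.2.1) else 0)) -
        ∑ i₂ : Fin m, ∑ μ ∈ 𝕊, α i₁ i₂ i μ * (1 + ε₀) ^ ((5 : ℝ) * (k - μ.2.2) / 2) *
          ((if -Kb ≤ k - μ.2.2 + μ.1 ∧ k - μ.2.2 + μ.1 ≤ Ka then Y' i₁ (k - μ.2.2 + μ.1) else 0) *
            (if -Kb ≤ k - μ.2.2 + μ.2.1 ∧ k - μ.2.2 + μ.2.1 ≤ Ka then Y' i₂ (k - μ.2.2 + μ.2.1) else 0))| ≤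
      D * ∑ i₂ : Fin m, ∑ μ ∈ 𝕊, |α i₁ i₂ i μ| * (1 + ε₀) ^ ((5 : ℝ) * (k - μ.2.2) / 2) *
          (boxSup Kb Ka lo hi i₁ (k - μ.2.2 + μ.1) * wExt Kb Ka ω (k - μ.2.2 + μ.2.1) +
            wExt Kb Ka ω (k - μ.2.2 + μ.1) * boxSup Kb Ka lo hi i₂ (k - μ.2.2 + μ.2.1)) := by
    intro i₁
    rw [← Finset.sum_sub_distrib, Finset.mul_sum]
    refine (Finset.abs_sum_le_sum_abs _ _).trans (Finset.sum_le_sum fun i₂ _ => ?_)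
    rw [← Finset.sum_sub_distrib, Finset.mul_sum]
    exact (Finset.abs_sum_le_sum_abs _ _).trans (Finset.sum_le_sum fun μ _ => hterm i₁ i₂ μ)
  refine (Finset.sum_le_sum fun i₁ _ => step i₁).trans ?_
  rw [← Finset.mul_sum]
  calc D * _ ≤ D * (K * ω k) := mul_le_mul_of_nonneg_left (htab i k hk1 hk2) hD
    _ = K * D * ω k := by ring

/-! ### Input defect and field range (nearest-neighbour shift sets) -/

/-- Under the edge-input bounds, every coordinate within reach of the window field is bounded by `Ĝ⁺`.
[folklore] -/
theorem abs_le_boxSupIn {Y : Fin m → ℤ → ℝ} (hY : InBoxOn Kb Ka lo hi Y) (hb : ∀ i, |Y i (-Kb - 1)| ≤ Eb)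
    (ht : ∀ i, |Y i (Ka + 1)| ≤ Et) (i : Fin m) {n : ℤ} (hn1 : -Kb - 1 ≤ n) (hn2 : n ≤ Ka + 1) :
    |Y i n| ≤ boxSupIn Kb Ka Eb Et lo hi i n := by
  unfold boxSupIn
  split_ifs with hw hb' ht'
  · exact abs_le_boxSup hY i hw
  · rw [hb']; exact hb i
  · rw [ht']; exact ht i
  · exfalso; omega

/-- The extended bound is nonnegative wherever it is used. [folklore] -/
theorem boxSupIn_nonneg_of {Y : Fin m → ℤ → ℝ} (hY : InBoxOn Kb Ka lo hi Y) (hb : ∀ i, |Y i (-Kb - 1)| ≤ Eb)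
    (ht : ∀ i, |Y i (Ka + 1)| ≤ Et) (i : Fin m) {n : ℤ} (hn1 : -Kb - 1 ≤ n) (hn2 : n ≤ Ka + 1) :
    0 ≤ boxSupIn Kb Ka Eb Et lo hi i n :=
  le_trans (abs_nonneg _) (abs_le_boxSupIn hY hb ht i hn1 hn2)

/-- One term of the input-defect estimate: if both slots are on the window the full and truncated products
agree, otherwise the full product is bounded by `Ĝ⁺_a Ĝ⁺_b` and the truncated one vanishes. [folklore] -/
theorem defect_term {Y : Fin m → ℤ → ℝ} (hY : InBoxOn Kb Ka lo hi Y) (hb : ∀ i, |Y i (-Kb - 1)| ≤ Eb)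
    (ht : ∀ i, |Y i (Ka + 1)| ≤ Et) (i₁ i₂ : Fin m) {a b : ℤ} (ha1 : -Kb - 1 ≤ a) (ha2 : a ≤ Ka + 1)
    (hb1 : -Kb - 1 ≤ b) (hb2 : b ≤ Ka + 1) :
    |Y i₁ a * Y i₂ b -
        (if -Kb ≤ a ∧ a ≤ Ka then Y i₁ a else 0) * (if -Kb ≤ b ∧ b ≤ Ka then Y i₂ b else 0)| ≤
      (if (-Kb ≤ a ∧ a ≤ Ka) ∧ (-Kb ≤ b ∧ b ≤ Ka) then 0
        else boxSupIn Kb Ka Eb Et lo hi i₁ a * boxSupIn Kb Ka Eb Et lo hi i₂ b) := by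
  have hA := abs_le_boxSupIn hY hb ht i₁ ha1 ha2
  have hB := abs_le_boxSupIn hY hb ht i₂ hb1 hb2
  by_cases hwa : -Kb ≤ a ∧ a ≤ Ka <;> by_cases hwb : -Kb ≤ b ∧ b ≤ Ka
  · simp [hwa, hwb]
  · rw [if_pos hwa, if_neg hwb, if_neg (fun h => hwb h.2), mul_zero, sub_zero, abs_mul]
    exact mul_le_mul hA hB (abs_nonneg _) (le_trans (abs_nonneg _) hA)
  · rw [if_neg hwa, if_pos hwb, if_neg (fun h => hwa h.1), zero_mul, sub_zero, abs_mul]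
    exact mul_le_mul hA hB (abs_nonneg _) (le_trans (abs_nonneg _) hA)
  · rw [if_neg hwa, if_neg hwb, if_neg (fun h => hwa h.1), zero_mul, sub_zero, abs_mul]
    exact mul_le_mul hA hB (abs_nonneg _) (le_trans (abs_nonneg _) hA)

/-- **INPUT DEFECT FROM THE TABLE** (nearest-neighbour `𝕊`): if for every window component
`Σ_{i₁,i₂,μ : a or b off the window} |α i₁ i₂ i μ| (1+ε₀)^{5(k−μ₃)/2} Ĝ⁺_{i₁}(a) Ĝ⁺_{i₂}(b) ≤ δ ω_k` then
`InputDefectOn … δ`. [cite: MooreKearfottCloud2009, §6.2–6.4 (interval enclosures of ranges); cell certificate format, box layer] -/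
theorem inputDefectOn_of_table (h𝕊 : IsNearestNeighbourSet 𝕊) (hε : 0 < 1 + ε₀) {δ : ℝ}
    (htab : ∀ i k, -Kb ≤ k → k ≤ Ka →
      ∑ i₁ : Fin m, ∑ i₂ : Fin m, ∑ μ ∈ 𝕊,
        |α i₁ i₂ i μ| * (1 + ε₀) ^ ((5 : ℝ) * (k - μ.2.2) / 2) *
          (if (-Kb ≤ k - μ.2.2 + μ.1 ∧ k - μ.2.2 + μ.1 ≤ Ka) ∧ (-Kb ≤ k - μ.2.2 + μ.2.1 ∧ k - μ.2.2 + μ.2.1 ≤ Ka)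
            then 0
            else boxSupIn Kb Ka Eb Et lo hi i₁ (k - μ.2.2 + μ.1) *
              boxSupIn Kb Ka Eb Et lo hi i₂ (k - μ.2.2 + μ.2.1)) ≤ δ * ω k) :
    InputDefectOn 𝕊 ε₀ α Kb Ka Eb Et ω lo hi δ := by
  intro Y hY hb ht i k hk1 hk2
  unfold truncField quadTermOn
  rw [← Finset.sum_sub_distrib]
  refine (Finset.abs_sum_le_sum_abs _ _).trans ?_
  refine le_trans (Finset.sum_le_sum fun i₁ _ => ?_) (htab i k hk1 hk2)
  rw [← Finset.sum_sub_distrib]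
  refine (Finset.abs_sum_le_sum_abs _ _).trans (Finset.sum_le_sum fun i₂ _ => ?_)
  rw [← Finset.sum_sub_distrib]
  refine (Finset.abs_sum_le_sum_abs _ _).trans (Finset.sum_le_sum fun μ hμ => ?_)
  obtain ⟨h1, h2, h3⟩ := h𝕊 μ hμ
  have hc : 0 ≤ (1 + ε₀) ^ ((5 : ℝ) * (k - μ.2.2) / 2) := (Real.rpow_pos_of_pos hε _).le
  rw [← mul_sub, abs_mul, abs_mul, abs_of_nonneg hc]
  refine mul_le_mul_of_nonneg_left ?_ (mul_nonneg (abs_nonneg _) hc)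
  exact defect_term hY hb ht i₁ i₂ (by omega) (by omega) (by omega) (by omega)

/-- **FIELD RANGE FROM THE TABLE** (nearest-neighbour `𝕊`): with `R i k := Σ_{i₁,i₂,μ} |α| (1+ε₀)^{5(k−μ₃)/2}
Ĝ⁺_{i₁}(a) Ĝ⁺_{i₂}(b)` (any upper bound of it), `FieldRangeOn … lo hi (−R) R`.
[cite: MooreKearfottCloud2009, §6.2–6.4 (interval enclosures of ranges); cell certificate format, box layer] -/
theorem fieldRangeOn_of_table (h𝕊 : IsNearestNeighbourSet 𝕊) (hε : 0 < 1 + ε₀) {R : Fin m → ℤ → ℝ}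
    (htab : ∀ i k, -Kb ≤ k → k ≤ Ka →
      ∑ i₁ : Fin m, ∑ i₂ : Fin m, ∑ μ ∈ 𝕊,
        |α i₁ i₂ i μ| * (1 + ε₀) ^ ((5 : ℝ) * (k - μ.2.2) / 2) *
          (boxSupIn Kb Ka Eb Et lo hi i₁ (k - μ.2.2 + μ.1) * boxSupIn Kb Ka Eb Et lo hi i₂ (k - μ.2.2 + μ.2.1)) ≤
        R i k) :
    FieldRangeOn 𝕊 ε₀ α Kb Ka Eb Et lo hi (fun i k => -R i k) R := by
  intro Y hY hb ht i k hk1 hk2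
  rw [← abs_le]
  unfold quadTermOn
  refine (Finset.abs_sum_le_sum_abs _ _).trans ?_
  refine le_trans (Finset.sum_le_sum fun i₁ _ => ?_) (htab i k hk1 hk2)
  refine (Finset.abs_sum_le_sum_abs _ _).trans (Finset.sum_le_sum fun i₂ _ => ?_)
  refine (Finset.abs_sum_le_sum_abs _ _).trans (Finset.sum_le_sum fun μ hμ => ?_)
  obtain ⟨h1, h2, h3⟩ := h𝕊 μ hμ
  have hc : 0 ≤ (1 + ε₀) ^ ((5 : ℝ) * (k - μ.2.2) / 2) := (Real.rpow_pos_of_pos hε _).le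
  rw [abs_mul, abs_mul, abs_of_nonneg hc, abs_mul]
  refine mul_le_mul_of_nonneg_left ?_ (mul_nonneg (abs_nonneg _) hc)
  have hA := abs_le_boxSupIn hY hb ht i₁ (n := k - μ.2.2 + μ.1) (by omega) (by omega)
  have hB := abs_le_boxSupIn hY hb ht i₂ (n := k - μ.2.2 + μ.2.1) (by omega) (by omega)
  exact mul_le_mul hA hB (abs_nonneg _) (le_trans (abs_nonneg _) hA)

end CertificateGlueOn

end Summit.NavierStokesRegularity.NavierStokesRegularity.Theorems

end
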